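import Summits.HodgeConjecture.HodgeConjecture.Theorems.Ring2WeilCoverageCMFieldIrrationalRowsBiquadratic
import Summits.HodgeConjecture.HodgeConjecture.Theorems.Ring2WeilCoverageCMFieldRowsA
import HarnessLib

/-!
# Weil-type components over quartic CM fields: the δ-ROW of a given member of the `ℚ(ζ₁₂)`-table —
# the rigid `C₃ × PGL₂(11)` eightfold `B_sym` (ring2-b05 b05.60 / ring2-b06 b06.24 P.S.) lies on the
# NON-SPLIT row `T = {(3, √3), (11, √3 − 5)}` = `{2, 3}` of census §b03.5, least representative `6 + √3`

research route conditional on HC_CM; not a corollary; Q11.4-sentence-2 already refuted in dim ≥ 3.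
Cell `pub-hodge-ring2`, seat `ring2-b03` (gen 60); kernel certificate for the Weil-type family-coverage census
`HOME/WEIL-FAMILY-COVERAGE.md` §b03 (operator priority5 2026-08-22T11:46:08Z), answering the ×2 invitations of
ring2-b06 (b06.24 P.S., 2026-08-24T11:48Z) and ring2-b05 (b05.60, 12:39:28Z): the `E`-hermitian discriminant of
the harmonic member `B_sym` of their datum #8 (`End⁰(B_sym) = E = ℚ(ζ₁₂) = ℚ(i,√3)`, `E`-signature `(2,2;2,2)`,
Hodge group `Res_{F/ℚ} SU(2,2)`) is `δ = det φ = 6 + (20/9)√3 ∈ F = ℚ(√3)` (their exact computation; taken here as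
GIVEN — nothing about `B_sym` itself is formalised).

On Deligne's carriers for this field (`R = S² + 8S + 4`, `σ = η² = −(1+√3)²`, so `√3 = −(σ+4)/2`; the split class at
`k = 2` is `[(-1)²] = [1]`), written on `{1, σ}`: `δ = 14/9 − (10/9)σ`, `9δ = 14 − 10σ` (norm `1716 = 2²·3·11·13`),
`81δ = 126 − 90σ` (ring2-b06's integral representative `486 + 180√3`, norm `138996`), and the least representative of
row `{2,3}` of §b03.5 is `6 + √3 = 4 − σ/2`, `4·(6 + √3) = 16 − 2σ` (the entry `(16,-2)` of
`zeta12_irrational_rows`). KERNEL CONTENT: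
* §0 (generic, any quadratic carrier `R = S² + pS + q`): `mk_eq_mk_of_coords` — an integer norm witness
  `(A + Bσ)² − σ(C + Dσ)² = (u + vσ)(u' + v'σ)` gives `[u + vσ] = [u' + v'σ]` (same component);
* §1 (`ℚ(ζ₁₂)`): `[14 − 10σ] = [16 − 2σ]` (witness `(16 − 2σ)² − σ(8 − σ)²`, i.e. `9δ·4(6+√3) = Nm_{E/F}((16 − 2σ) + (8 − σ)η)`,
  equivalently `δ/(6 + √3) = (4 − σ)/9 = Nm_{E/F}(2 + η)/3²` with `4 − σ = 8 + 2√3`; also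
  `(14 − 10σ)/(16 − 2σ) = (4 − σ)/4 = Nm_{E/F}(2 + η)/2²`),
  `[126 − 90σ] = [16 − 2σ]`, `[δ] = [16 − 2σ]` for `δ = 14/9 − (10/9)σ` itself, and `[6 + √3] = [16 − 2σ]`;
  `[14 − 10σ] ≠ [c]` and `[126 − 90σ] ≠ [c]` for EVERY `c ∈ ℚ^×` (norm parity at `ℓ = 11`: `1716 = 11·156`,
  `138996 = 11·12636`), in particular `≠ [1]`: the component of `B_sym` is NON-SPLIT (no `E`-Lagrangian, Deligne
  Cor. 4.2) and is none of the integer-indexed rows `[n]`; packaged literal statement `zeta12_harmonicMember_row`.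
The local-symbol reading `T(δ) = {(3,√3), (11, √3 − 5)}` (ring2-b06: `v_{(√3)}(81δ) = 5`, `v_{(1+2√3)}(81δ) = 1`, `E/F`
unramified at finite places) is the census's (PARI `nfhilbert` + stdlib tame symbols ×2, kit j220856); the kernel
states the same fact as «same class as the tabulated representative of row `{2,3}`, and no rational representative».

No named fact, no definition, no `sorry`; nothing about the Hodge conjecture, about `B_sym`, or about the Weil classes
of any member is asserted.
References: [Deligne1982HodgeCycles] §4 p. 30 (1), Cor. 4.2, Lemma 4.6; [Landherr1936HermitianForms]. -/

noncomputable section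

set_option linter.dupNamespace false

open Polynomial

namespace Summit.HodgeConjecture.HodgeConjecture.Ring2.WeilCoverageCM

open Literature.AlgebraicGeometry.Deligne1982
open Literature.AlgebraicGeometry.HodgeTheory (splitDiscriminantClassCM)

/-! ### §0 Generic: the same row from an integer norm witness for the product -/

/-- **Same component from a norm witness for the product.** On Deligne's carriers `F = ℚ[S]/(R)`,
`E = ℚ[T]/(R(T²))`, `R = S² + pS + q`: integers `A, B, C, D` with `(A + Bσ)² − σ(C + Dσ)² = (u + vσ)(u' + v'σ)` — i.e.
the two coordinate identities `X(A,B,C,D) = uu' − qvv'`, `Y(A,B,C,D) = uv' + u'v − pvv'` of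
`NormDescent.normForm_coords` (using `σ² = −pσ − q`) — give `[u + vσ] = [u' + v'σ]` in `F^×/Nm_{E/F}(E^×)`
(`(u + vσ)(u' + v'σ) = Nm_{E/F}((A + Bσ) + (C + Dσ)η)` is a norm and every class has order `≤ 2`,
`mk_eq_mk_of_mk_mul_eq_split`): the two discriminants label the SAME Weil-type component `W8.E.δ`.
[cite: Deligne1982HodgeCycles, §4 p. 30 (1)] -/
theorem mk_eq_mk_of_coords {p q : ℤ} {R : Polynomial ℤ}
    (hR : R = X ^ 2 + C p * X + C q) [Fact (Irreducible (realPolyQ R))] [Fact (Irreducible (cmPolyQ R))]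
    (u v u' v' A B Cc D : ℤ)
    (hX : A ^ 2 - q * B ^ 2 + 2 * q * Cc * D - p * q * D ^ 2 = u * u' - q * v * v')
    (hY : 2 * A * B - p * B ^ 2 - Cc ^ 2 + 2 * p * Cc * D - (p ^ 2 - q) * D ^ 2 = u * v' + u' * v - p * v * v')
    (δ : (realField R)ˣ)
    (hδ : (δ : realField R) = AdjoinRoot.of (realPolyQ R) u + AdjoinRoot.of (realPolyQ R) v * AdjoinRoot.root (realPolyQ R))
    (δ' : (realField R)ˣ)
    (hδ' : (δ' : realField R) = AdjoinRoot.of (realPolyQ R) u' + AdjoinRoot.of (realPolyQ R) v' * AdjoinRoot.root (realPolyQ R)) :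
    (QuotientGroup.mk δ : cmNormResidueGroup R) = QuotientGroup.mk δ' := by
  have key := normForm_coords hR (A : ℚ) (B : ℚ) (Cc : ℚ) (D : ℚ)
  have hXq : (A : ℚ) ^ 2 - q * (B : ℚ) ^ 2 + 2 * q * (Cc : ℚ) * D - p * q * (D : ℚ) ^ 2
      = u * u' - q * v * v' := by
    exact_mod_cast hX
  have hYq : 2 * (A : ℚ) * B - p * (B : ℚ) ^ 2 - (Cc : ℚ) ^ 2 + 2 * p * (Cc : ℚ) * D
      - ((p : ℚ) ^ 2 - q) * (D : ℚ) ^ 2 = u * v' + u' * v - p * v * v' := by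
    exact_mod_cast hY
  rw [hXq, hYq] at key
  have hσ := root_rel_quadratic hR
  have hp : ((p : ℚ) : realField R) = AdjoinRoot.of (realPolyQ R) p := (map_ratCast _ _).symm
  have hq : ((q : ℚ) : realField R) = AdjoinRoot.of (realPolyQ R) q := (map_ratCast _ _).symm
  rw [hp, hq] at hσ
  apply mk_eq_mk_of_mk_mul_eq_split
  refine mk_eq_splitDiscriminantClassCM_two_of_normForm (δ * δ')
    (AdjoinRoot.of (realPolyQ R) A + AdjoinRoot.of (realPolyQ R) B * AdjoinRoot.root (realPolyQ R))
    (AdjoinRoot.of (realPolyQ R) Cc + AdjoinRoot.of (realPolyQ R) D * AdjoinRoot.root (realPolyQ R)) 1 one_ne_zero ?_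
  rw [key, one_pow, mul_one, Units.val_mul, hδ, hδ']
  simp only [map_add, map_sub, map_mul]
  linear_combination (-(AdjoinRoot.of (realPolyQ R) (v : ℚ) * AdjoinRoot.of (realPolyQ R) (v' : ℚ))) * hσ

/-- **Rescaling by a rational square does not change the row**: `(δ' : F) = c² · δ` with `c ∈ ℚ^×` gives
`[δ'] = [δ]` (`c² = Nm_{E/F}(c)`). [cite: Deligne1982HodgeCycles, §4 p. 30] -/
theorem mk_eq_mk_of_eq_ratCast_sq_mul {R : Polynomial ℤ} [Fact (Irreducible (realPolyQ R))]
    [Fact (Irreducible (cmPolyQ R))] (δ δ' : (realField R)ˣ) (c : ℚ) (hc : c ≠ 0)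
    (h : (δ' : realField R) = (c : realField R) ^ 2 * δ) :
    (QuotientGroup.mk δ' : cmNormResidueGroup R) = QuotientGroup.mk δ := by
  have hc' : (c : realField R) ≠ 0 := by
    rw [← map_ratCast (AdjoinRoot.of (realPolyQ R)), Ne, map_eq_zero_iff _ (AdjoinRoot.of (realPolyQ R)).injective]
    exact_mod_cast hc
  set w : (realField R)ˣ := Units.mk0 (c : realField R) hc' with hw
  have e : δ' = δ * w ^ 2 := Units.ext (by rw [Units.val_mul, Units.val_pow_eq_pow_val, hw, Units.val_mk0, h, mul_comm])
  rw [e, mk_mul_sq_cmNormResidueGroup]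

/-! ### §1 `E = ℚ(ζ₁₂) = ℚ(i,√3)`: `R = S² + 8S + 4`, `σ = −(1+√3)²`, `√3 = −(σ+4)/2` -/

section Zeta12

variable {R : Polynomial ℤ} (hR : R = X ^ 2 + C 8 * X + C 4) [Fact (Irreducible (realPolyQ R))]
include hR

/-- **`[9δ] = [4(6+√3)]` for the harmonic member**: `[14 − 10σ] = [16 − 2σ]` in `F^×/Nm_{E/F}(E^×)`, `E = ℚ(ζ₁₂)`
— the witness `(16 − 2σ)² − σ(8 − σ)² = 144 − 348σ = (14 − 10σ)(16 − 2σ)` (i.e. `(14 − 10σ)/(16 − 2σ) = (4 − σ)/4 =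
Nm_{E/F}(2 + η)/2²`): `B_sym`'s discriminant `δ = (14 − 10σ)/9 = 6 + (20/9)√3` lies on the row of the least
representative `6 + √3 = (16 − 2σ)/4` — row `T = {(3,√3), (11,√3−5)} = {2,3}` of census §b03.5.
[cite: Deligne1982HodgeCycles, §4 p. 30 (1)] -/
theorem zeta12_mk_harmonic9_eq_mk_row23 (δ : (realField R)ˣ)
    (hδ : (δ : realField R) = AdjoinRoot.of (realPolyQ R) (14 : ℤ) + AdjoinRoot.of (realPolyQ R) (-10 : ℤ) * AdjoinRoot.root (realPolyQ R))
    (ρ : (realField R)ˣ)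
    (hρ : (ρ : realField R) = AdjoinRoot.of (realPolyQ R) (16 : ℤ) + AdjoinRoot.of (realPolyQ R) (-2 : ℤ) * AdjoinRoot.root (realPolyQ R)) :
    (QuotientGroup.mk δ : cmNormResidueGroup R) = QuotientGroup.mk ρ := by
  haveI : Fact (Irreducible (cmPolyQ R)) := fact_irreducible_cmPolyQ_of_pos hR (by norm_num) (by norm_num) disc_not_sq_eight_four
  exact mk_eq_mk_of_coords hR 14 (-10) 16 (-2) 16 (-2) 8 (-1) (by norm_num) (by norm_num) δ hδ ρ hρ

/-- **`[81δ] = [4(6+√3)]`**: ring2-b06's integral representative `81δ = 486 + 180√3 = 126 − 90σ` has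
`[126 − 90σ] = [16 − 2σ]` — witness `(48 − 6σ)² − σ(24 − 3σ)² = 1296 − 3132σ = (126 − 90σ)(16 − 2σ)`.
[cite: Deligne1982HodgeCycles, §4 p. 30 (1)] -/
theorem zeta12_mk_harmonic81_eq_mk_row23 (δ : (realField R)ˣ)
    (hδ : (δ : realField R) = AdjoinRoot.of (realPolyQ R) (126 : ℤ) + AdjoinRoot.of (realPolyQ R) (-90 : ℤ) * AdjoinRoot.root (realPolyQ R))
    (ρ : (realField R)ˣ)
    (hρ : (ρ : realField R) = AdjoinRoot.of (realPolyQ R) (16 : ℤ) + AdjoinRoot.of (realPolyQ R) (-2 : ℤ) * AdjoinRoot.root (realPolyQ R)) :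
    (QuotientGroup.mk δ : cmNormResidueGroup R) = QuotientGroup.mk ρ := by
  haveI : Fact (Irreducible (cmPolyQ R)) := fact_irreducible_cmPolyQ_of_pos hR (by norm_num) (by norm_num) disc_not_sq_eight_four
  exact mk_eq_mk_of_coords hR 126 (-90) 16 (-2) 48 (-6) 24 (-3) (by norm_num) (by norm_num) δ hδ ρ hρ

/-- **`[δ] = [4(6+√3)]` for `δ = 6 + (20/9)√3 = 14/9 − (10/9)σ` itself** (`δ = (1/3)²·(14 − 10σ)`).
[cite: Deligne1982HodgeCycles, §4 p. 30 (1)] -/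
theorem zeta12_mk_harmonicDelta_eq_mk_row23 (δ : (realField R)ˣ)
    (hδ : (δ : realField R) = AdjoinRoot.of (realPolyQ R) (14 / 9 : ℚ) + AdjoinRoot.of (realPolyQ R) (-10 / 9 : ℚ) * AdjoinRoot.root (realPolyQ R))
    (ρ : (realField R)ˣ)
    (hρ : (ρ : realField R) = AdjoinRoot.of (realPolyQ R) (16 : ℤ) + AdjoinRoot.of (realPolyQ R) (-2 : ℤ) * AdjoinRoot.root (realPolyQ R)) :
    (QuotientGroup.mk δ : cmNormResidueGroup R) = QuotientGroup.mk ρ := by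
  haveI : Fact (Irreducible (cmPolyQ R)) := fact_irreducible_cmPolyQ_of_pos hR (by norm_num) (by norm_num) disc_not_sq_eight_four
  -- `γ = 14 − 10σ = 3²·δ`
  have h9 : AdjoinRoot.of (realPolyQ R) (14 : ℤ) + AdjoinRoot.of (realPolyQ R) (-10 : ℤ) * AdjoinRoot.root (realPolyQ R) ≠ 0 := by
    intro h0
    have := (coords_eq_zero_quadratic hR h0).1
    norm_num at this
  set γ : (realField R)ˣ := Units.mk0 _ h9 with hγ
  have e : (QuotientGroup.mk γ : cmNormResidueGroup R) = QuotientGroup.mk δ := by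
    refine mk_eq_mk_of_eq_ratCast_sq_mul δ γ 3 (by norm_num) ?_
    rw [hγ, Units.val_mk0, hδ, ← map_ratCast (AdjoinRoot.of (realPolyQ R))]
    simp only [← map_pow, ← map_mul, mul_add, ← mul_assoc]
    congr 1 <;> norm_num
  rw [← e]
  exact zeta12_mk_harmonic9_eq_mk_row23 hR γ (by rw [hγ, Units.val_mk0]) ρ hρ

/-- **`[6 + √3] = [4(6+√3)]`**: the least representative itself, `6 + √3 = 4 − σ/2 = (1/2)²·(16 − 2σ)`.
[cite: Deligne1982HodgeCycles, §4 p. 30 (1)] -/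
theorem zeta12_mk_row23_rep_eq (δ : (realField R)ˣ)
    (hδ : (δ : realField R) = AdjoinRoot.of (realPolyQ R) (4 : ℚ) + AdjoinRoot.of (realPolyQ R) (-1 / 2 : ℚ) * AdjoinRoot.root (realPolyQ R))
    (ρ : (realField R)ˣ)
    (hρ : (ρ : realField R) = AdjoinRoot.of (realPolyQ R) (16 : ℤ) + AdjoinRoot.of (realPolyQ R) (-2 : ℤ) * AdjoinRoot.root (realPolyQ R)) :
    (QuotientGroup.mk δ : cmNormResidueGroup R) = QuotientGroup.mk ρ := by
  haveI : Fact (Irreducible (cmPolyQ R)) := fact_irreducible_cmPolyQ_of_pos hR (by norm_num) (by norm_num) disc_not_sq_eight_four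
  refine mk_eq_mk_of_eq_ratCast_sq_mul ρ δ (1 / 2) (by norm_num) ?_
  rw [hρ, hδ, ← map_ratCast (AdjoinRoot.of (realPolyQ R))]
  simp only [← map_pow, ← map_mul, mul_add, ← mul_assoc]
  congr 1 <;> norm_num

/-- **No rational representative: `[9δ] = [14 − 10σ] ≠ [c]` for EVERY `c ∈ ℚ^×`** (norm `N_{F/ℚ}(14 − 10σ) =
1716 = 11·156`, `11 ∤ 156`; every place of `F` over `11` is inert in `E/F`: norm parity, `zeta12_mk_ne_mk_ratCast_of_norm_eleven`)
— the component of `B_sym` is none of the integer-indexed rows `[n]` of the `ℚ(ζ₁₂)` table.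
[cite: Deligne1982HodgeCycles, §4 p. 30 (1) and Cor. 4.2] -/
theorem zeta12_mk_harmonic9_ne_mk_ratCast (δ : (realField R)ˣ)
    (hδ : (δ : realField R) = AdjoinRoot.of (realPolyQ R) (14 : ℤ) + AdjoinRoot.of (realPolyQ R) (-10 : ℤ) * AdjoinRoot.root (realPolyQ R))
    (c : ℚ) (γ : (realField R)ˣ) (hγ : (γ : realField R) = (c : realField R)) :
    (QuotientGroup.mk δ : cmNormResidueGroup R) ≠ QuotientGroup.mk γ :=
  zeta12_mk_ne_mk_ratCast_of_norm_eleven hR 14 (-10) 156 (by norm_num) (by norm_num) δ hδ c γ hγ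

/-- **`[81δ] = [126 − 90σ] ≠ [c]` for EVERY `c ∈ ℚ^×`** (norm `138996 = 11·12636`, `11 ∤ 12636`).
[cite: Deligne1982HodgeCycles, §4 p. 30 (1) and Cor. 4.2] -/
theorem zeta12_mk_harmonic81_ne_mk_ratCast (δ : (realField R)ˣ)
    (hδ : (δ : realField R) = AdjoinRoot.of (realPolyQ R) (126 : ℤ) + AdjoinRoot.of (realPolyQ R) (-90 : ℤ) * AdjoinRoot.root (realPolyQ R))
    (c : ℚ) (γ : (realField R)ˣ) (hγ : (γ : realField R) = (c : realField R)) :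
    (QuotientGroup.mk δ : cmNormResidueGroup R) ≠ QuotientGroup.mk γ :=
  zeta12_mk_ne_mk_ratCast_of_norm_eleven hR 126 (-90) 12636 (by norm_num) (by norm_num) δ hδ c γ hγ

/-- **The component of `B_sym` is NON-SPLIT**: `[14 − 10σ] ≠ [(-1)²]` — no `E`-Lagrangian member (Deligne Cor. 4.2).
[cite: Deligne1982HodgeCycles, §4 Cor. 4.2] -/
theorem zeta12_mk_harmonic9_ne_split (δ : (realField R)ˣ)
    (hδ : (δ : realField R) = AdjoinRoot.of (realPolyQ R) (14 : ℤ) + AdjoinRoot.of (realPolyQ R) (-10 : ℤ) * AdjoinRoot.root (realPolyQ R)) :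
    (QuotientGroup.mk δ : cmNormResidueGroup R) ≠ splitDiscriminantClassCM R 2 := by
  rw [splitDiscriminantClassCM, neg_one_sq]
  exact zeta12_mk_harmonic9_ne_mk_ratCast hR δ hδ 1 1 (by rw [Units.val_one, Rat.cast_one])

/-- **`[δ] ≠ [(-1)²]` for `δ = 6 + (20/9)√3 = 14/9 − (10/9)σ` itself.** [cite: Deligne1982HodgeCycles, §4 Cor. 4.2] -/
theorem zeta12_mk_harmonicDelta_ne_split (δ : (realField R)ˣ)
    (hδ : (δ : realField R) = AdjoinRoot.of (realPolyQ R) (14 / 9 : ℚ) + AdjoinRoot.of (realPolyQ R) (-10 / 9 : ℚ) * AdjoinRoot.root (realPolyQ R)) :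
    (QuotientGroup.mk δ : cmNormResidueGroup R) ≠ splitDiscriminantClassCM R 2 := by
  haveI : Fact (Irreducible (cmPolyQ R)) := fact_irreducible_cmPolyQ_of_pos hR (by norm_num) (by norm_num) disc_not_sq_eight_four
  have h16 : AdjoinRoot.of (realPolyQ R) (16 : ℤ) + AdjoinRoot.of (realPolyQ R) (-2 : ℤ) * AdjoinRoot.root (realPolyQ R) ≠ 0 := by
    intro h0
    have := (coords_eq_zero_quadratic hR h0).1
    norm_num at this
  have h14 : AdjoinRoot.of (realPolyQ R) (14 : ℤ) + AdjoinRoot.of (realPolyQ R) (-10 : ℤ) * AdjoinRoot.root (realPolyQ R) ≠ 0 := by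
    intro h0
    have := (coords_eq_zero_quadratic hR h0).1
    norm_num at this
  rw [zeta12_mk_harmonicDelta_eq_mk_row23 hR δ hδ (Units.mk0 _ h16) (Units.val_mk0 _),
    ← zeta12_mk_harmonic9_eq_mk_row23 hR (Units.mk0 _ h14) (Units.val_mk0 _) (Units.mk0 _ h16) (Units.val_mk0 _)]
  exact zeta12_mk_harmonic9_ne_split hR _ (Units.val_mk0 _)

end Zeta12

/-- **The δ-row of the harmonic member, literal packaging** (`R = X ^ 2 + C 8 * X + C 4` LITERALLY, instances
supplied): for every unit `δ` of `F = ℚ(√3)` with `δ = 14/9 − (10/9)σ` (`= 6 + (20/9)√3`, `√3 = −(σ+4)/2`) and the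
unit `ρ = 16 − 2σ` (`= 4(6+√3)`, the entry `(16,-2)` of `zeta12_irrational_rows`, row `T = {(3,√3),(11,√3−5)}` of
§b03.5): `[δ] = [ρ]`, `[δ] ≠ [(-1)²]` (non-split), and `[ρ] ≠ [c]` for every `c ∈ ℚ^×` (no rational representative).
[cite: Deligne1982HodgeCycles, §4 p. 30 (1) and Cor. 4.2] -/
theorem zeta12_harmonicMember_row :
    haveI := fact_irreducible_realPolyQ_of_not_sq (R := X ^ 2 + C 8 * X + C 4) rfl disc_not_sq_eight_four
    ∀ δ ρ : (realField (X ^ 2 + C 8 * X + C 4))ˣ,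
      (δ : realField (X ^ 2 + C 8 * X + C 4)) = AdjoinRoot.of (realPolyQ (X ^ 2 + C 8 * X + C 4)) (14 / 9 : ℚ)
          + AdjoinRoot.of (realPolyQ (X ^ 2 + C 8 * X + C 4)) (-10 / 9 : ℚ) * AdjoinRoot.root (realPolyQ (X ^ 2 + C 8 * X + C 4)) →
      (ρ : realField (X ^ 2 + C 8 * X + C 4)) = AdjoinRoot.of (realPolyQ (X ^ 2 + C 8 * X + C 4)) ((16 : ℤ) : ℚ)
          + AdjoinRoot.of (realPolyQ (X ^ 2 + C 8 * X + C 4)) ((-2 : ℤ) : ℚ) * AdjoinRoot.root (realPolyQ (X ^ 2 + C 8 * X + C 4)) →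
        (QuotientGroup.mk δ : cmNormResidueGroup (X ^ 2 + C 8 * X + C 4)) = QuotientGroup.mk ρ ∧
        (QuotientGroup.mk δ : cmNormResidueGroup (X ^ 2 + C 8 * X + C 4)) ≠ splitDiscriminantClassCM (X ^ 2 + C 8 * X + C 4) 2 ∧
        ∀ (c : ℚ) (γ : (realField (X ^ 2 + C 8 * X + C 4))ˣ),
          (γ : realField (X ^ 2 + C 8 * X + C 4)) = (c : realField (X ^ 2 + C 8 * X + C 4)) →
          (QuotientGroup.mk ρ : cmNormResidueGroup (X ^ 2 + C 8 * X + C 4)) ≠ QuotientGroup.mk γ := by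
  haveI := fact_irreducible_realPolyQ_of_not_sq (R := X ^ 2 + C 8 * X + C 4) rfl disc_not_sq_eight_four
  intro δ ρ hδ hρ
  refine ⟨zeta12_mk_harmonicDelta_eq_mk_row23 rfl δ hδ ρ hρ, zeta12_mk_harmonicDelta_ne_split rfl δ hδ, ?_⟩
  intro c γ hγ
  exact zeta12_mk_ne_mk_ratCast_of_norm_three rfl 16 (-2) (176) (by norm_num) (by norm_num) ρ hρ c γ hγ

end Summit.HodgeConjecture.HodgeConjecture.Ring2.WeilCoverageCM

end
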